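import Summits.CriticalPhenomena.PercolationContinuityZ3.Theorems.PercNearOneGluingNoHeavyLowerTailFKAnalogues
import HarnessLib

/-!
# `¬ FK.AdditiveGluingFKGLattice`: additive gluing FAILS for a monotonic (FKG-lattice) measure — an exact 5-edge witness

Refutation file (`--supports stmt-CriticalPhenomena-4575 --as helper`), FK sub-lane `prim-bschramm-fk-1`; builds on p205010 (kernel
theorem, internal audit signed; external expert review pending).  The conjecture-shaped statement `FK.AdditiveGluingFKGLattice` of
`PercNearOneGluingNoHeavyLowerTailFKAnalogues.lean` ("additive gluing holds under every probability measure on `{0,1}^{Sym2 (Fin n)}`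
satisfying the FKG lattice condition") is FALSE.  Witness (found by the exact census of seat prim-bschramm-fk-2, memo FK-Q2.md §6.5,
re-derived independently; here certified by the kernel): the graph `K₄` minus the edge `01` (edges `02, 03, 12, 13, 23`, indexed
`0,…,4`), the probability measure `μ(ω) ∝ (4/5)^{|ω|} (1/5)^{5-|ω|} ∏_{i<j, both open} (1 + b_{ij})` with the pairwise ferromagnetic
couplings `b = {(02,03):1, (02,13):2, (02,23):1, (03,12):3, (03,13):2, (12,13):2, (13,23):3}` (all other pairs `0`), which satisfies the
FKG lattice condition `μ{a}μ{b} ≤ μ{a∩b}μ{a∪b}` (hence is monotonic / strongly positively associated, Grimmett 2006 Thm. (2.19), (2.24)),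
and the data `o = 0`, `b = 1`, `A = {2, 3}`: `μ(o ↮ b) = 1365/1929685 > μ(o ↮ A) + max_{a∈A} μ(a ↮ b) = 909/1929685 + 449/1929685`,
margin `7/1929685`.  So the finite gluing inequalities are NOT truths about all FKG measures; the census-supported conjecture for
random-cluster measures (`FK.AdditiveGluingFKMonotone`) is untouched.

Method: the `2^5 = 32` configurations are indexed by `Finset (Fin 5)`; the weights `mQ`, a breadth-first reachability test `reachB`
(walks of length `≤ 3` suffice on `4` vertices) and the event masses are computable rationals, evaluated by `decide +kernel` (standard
axioms; ~10 s); the bridge lemmas identify `μ.real (openConn u v)` with these rationals (`reachB_iff` proves the reachability test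
correct against Mathlib's `SimpleGraph.Reachable`) and the lattice condition on point masses with the `decide`d inequality on `mQ`.
[cite: Grimmett2006, Thm. (2.19) and Thm. (2.24) (FKG lattice condition ⇒ monotonic)] [cite: KozmaNitzan2024, Conj. 1 (p. 3)]
-/

namespace Summit.CriticalPhenomena.PercolationContinuityZ3.Theorems

namespace FK

namespace FKGLatticeCex

open MeasureTheory Literature.Probability.Percolation
open Literature.Probability.Percolation.DecisionTree (ind ind_of_mem ind_of_not_mem)

/-! ### Computable data of the witness -/

/-- First endpoints of the five edges `02, 03, 12, 13, 23`. (transcription of FK-Q2.md §6.5) -/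
def src : Fin 5 → Fin 4 := ![0, 0, 1, 1, 2]

/-- Second endpoints of the five edges `02, 03, 12, 13, 23`. (transcription of FK-Q2.md §6.5) -/
def dst : Fin 5 → Fin 4 := ![2, 3, 2, 3, 3]

/-- The nonzero pairwise couplings `(i, j, b_{ij})`. (transcription of FK-Q2.md §6.5) -/
def pairs : List (Fin 5 × Fin 5 × ℕ) :=
  [(0, 1, 1), (0, 3, 2), (0, 4, 1), (1, 2, 3), (1, 3, 2), (2, 3, 2), (3, 4, 3)]

/-- The ferromagnetic tilt `∏_{(i,j)} (1 + b_{ij})^{[i, j open]}`. (transcription of FK-Q2.md §6.5) -/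
def tiltQ (t : Finset (Fin 5)) : ℚ :=
  (pairs.map fun p => if p.1 ∈ t ∧ p.2.1 ∈ t then (1 + p.2.2 : ℚ) else 1).prod

/-- The (unnormalised) weight `(4/5)^{|t|} (1/5)^{5-|t|} · tilt(t)` of the configuration with open edge set `t`.
(transcription of FK-Q2.md §6.5) -/
def mQ (t : Finset (Fin 5)) : ℚ := (4 / 5 : ℚ) ^ t.card * (1 / 5 : ℚ) ^ (5 - t.card) * tiltQ t

/-- Adjacency of two vertices through an open edge of `t` (computable). [folklore] -/
def adjB (t : Finset (Fin 5)) (x y : Fin 4) : Bool :=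
  decide (x ≠ y) && (List.finRange 5).any
    (fun i => decide (i ∈ t) && ((decide (src i = x) && decide (dst i = y)) || (decide (src i = y) && decide (dst i = x))))

/-- `reachWithin t k u v`: `v` is reached from `u` by an open walk of length at most `k` (computable). [folklore] -/
def reachWithin (t : Finset (Fin 5)) : ℕ → Fin 4 → Fin 4 → Bool
  | 0, u, v => decide (u = v)
  | k + 1, u, v => decide (u = v) || (List.finRange 4).any (fun w => adjB t u w && reachWithin t k w v)

/-- Reachability through open edges of `t` (walks of length `≤ 3` suffice on four vertices). [folklore] -/
def reachB (t : Finset (Fin 5)) (u v : Fin 4) : Bool := reachWithin t 3 u v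

/-- The partition function `Z = Σ_t mQ t`. (transcription of FK-Q2.md §6.5) -/
def ZQ : ℚ := ∑ t : Finset (Fin 5), mQ t

/-- The unnormalised mass of a (computable) event. (transcription of FK-Q2.md §6.5) -/
def massQ (P : Finset (Fin 5) → Bool) : ℚ := ∑ t : Finset (Fin 5), if P t then mQ t else 0

/-! ### The kernel certificate (exact rational arithmetic, `decide +kernel`) -/

/-- `Z = 385937/625` (so `3125 Z = 1929685`). (transcription of FK-Q2.md §6.5) -/
theorem zq_eq : ZQ = 385937 / 625 := by decide +kernel

/-- Mass of `{0 ↔ 1}`: `385664/625`, i.e. `μ(0 ↮ 1) = 1365/1929685`. (transcription of FK-Q2.md §6.5) -/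
theorem mass_conn01 : massQ (fun t => reachB t 0 1) = 385664 / 625 := by decide +kernel

/-- Mass of `{0 ↔ 2} ∪ {0 ↔ 3}`: `1928776/3125`, i.e. `μ(0 ↮ {2,3}) = 909/1929685`. (transcription of FK-Q2.md §6.5) -/
theorem mass_conn0A : massQ (fun t => reachB t 0 2 || reachB t 0 3) = 1928776 / 3125 := by decide +kernel

/-- Mass of `{2 ↔ 1}`: `1929236/3125`, i.e. `μ(2 ↮ 1) = 449/1929685`. (transcription of FK-Q2.md §6.5) -/
theorem mass_conn21 : massQ (fun t => reachB t 2 1) = 1929236 / 3125 := by decide +kernel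

/-- Mass of `{3 ↔ 1}`: `1929252/3125`, i.e. `μ(3 ↮ 1) = 433/1929685`. (transcription of FK-Q2.md §6.5) -/
theorem mass_conn31 : massQ (fun t => reachB t 3 1) = 1929252 / 3125 := by decide +kernel

/-- **The FKG lattice condition of the weights**, checked on all `32 × 32` pairs. [cite: Grimmett2006, Thm. (2.19) (FKG lattice condition)] -/
theorem mQ_lattice : ∀ s t : Finset (Fin 5), mQ s * mQ t ≤ mQ (s ∩ t) * mQ (s ∪ t) := by decide +kernel

/-- The weights are nonnegative. [folklore] -/
theorem mQ_nonneg : ∀ t : Finset (Fin 5), 0 ≤ mQ t := by decide +kernel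

/-! ### The measure -/

/-- The five edges as unordered pairs of vertices: `i ↦ {src i, dst i}`, an embedding `Fin 5 ↪ Sym2 (Fin 4)`. [folklore] -/
def edgeEmb : Fin 5 ↪ Sym2 (Fin 4) :=
  ⟨fun i => s(src i, dst i), by decide⟩

/-- The bond configuration (set of open pairs) with open edge set `t`. [folklore] -/
def conf (t : Finset (Fin 5)) : BondConfig (Fin 4) := ↑(t.map edgeEmb)

/-- `conf` is injective. [folklore] -/
theorem conf_injective : Function.Injective conf := fun _ _ h =>
  Finset.map_injective edgeEmb (Finset.coe_injective h)

/-- `conf` preserves intersections. [folklore] -/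
theorem conf_inter (s t : Finset (Fin 5)) : conf (s ∩ t) = conf s ∩ conf t := by
  unfold conf; rw [Finset.map_inter, Finset.coe_inter]

/-- `conf` preserves unions. [folklore] -/
theorem conf_union (s t : Finset (Fin 5)) : conf (s ∪ t) = conf s ∪ conf t := by
  unfold conf; rw [Finset.map_union, Finset.coe_union]

noncomputable section

open scoped Classical

/-- **The witness measure** `μ = Σ_t (mQ t / Z) δ_{conf t}` on bond configurations of `Fin 4`. (transcription of FK-Q2.md §6.5) -/
def μ : Measure (BondConfig (Fin 4)) :=
  ∑ t : Finset (Fin 5), ENNReal.ofReal ((mQ t : ℝ) / (ZQ : ℝ)) • Measure.dirac (conf t)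

/-- The measure of an event as a finite sum. [folklore] -/
theorem μ_real_apply (X : Set (BondConfig (Fin 4))) :
    μ.real X = ∑ t : Finset (Fin 5), if conf t ∈ X then (mQ t : ℝ) / (ZQ : ℝ) else 0 := by
  classical
  have hZ : (0 : ℝ) < (ZQ : ℝ) := by rw [zq_eq]; push_cast; norm_num
  have hnn : ∀ t, 0 ≤ (mQ t : ℝ) / (ZQ : ℝ) := fun t =>
    div_nonneg (by exact_mod_cast mQ_nonneg t) hZ.le
  have h1 : μ X = ∑ t : Finset (Fin 5),
      ENNReal.ofReal (if conf t ∈ X then (mQ t : ℝ) / (ZQ : ℝ) else 0) := by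
    simp only [μ, Measure.coe_finsetSum, Measure.coe_smul, Finset.sum_apply, Pi.smul_apply, smul_eq_mul,
      Measure.dirac_apply, Set.indicator_apply, Pi.one_apply, mul_ite, mul_one, mul_zero]
    refine Finset.sum_congr rfl fun t _ => ?_
    split_ifs <;> simp
  rw [measureReal_def, h1, ← ENNReal.ofReal_sum_of_nonneg, ENNReal.toReal_ofReal]
  · exact Finset.sum_nonneg fun t _ => by split_ifs <;> [exact hnn t; exact le_rfl]
  · intro t _; split_ifs <;> [exact hnn t; exact le_rfl]

/-- The measure of an event described by a computable predicate on the open edge set: `μ(X) = massQ P / Z`. [folklore] -/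
theorem μ_real_eq_massQ {X : Set (BondConfig (Fin 4))} {P : Finset (Fin 5) → Bool}
    (h : ∀ t, conf t ∈ X ↔ P t = true) : μ.real X = (massQ P : ℝ) / (ZQ : ℝ) := by
  rw [μ_real_apply, massQ, Rat.cast_sum, Finset.sum_div]
  refine Finset.sum_congr rfl fun t _ => ?_
  by_cases hP : P t = true
  · rw [if_pos ((h t).2 hP), if_pos hP]
  · rw [if_neg (fun hX => hP ((h t).1 hX)), if_neg hP, Rat.cast_zero, zero_div]

/-- `μ` has total mass one. [folklore] -/
theorem μ_univ : μ Set.univ = 1 ∧ ZQ = 385937 / 625 := by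
  refine ⟨?_, zq_eq⟩
  have hZ : (0 : ℝ) < (ZQ : ℝ) := by rw [zq_eq]; push_cast; norm_num
  have h := μ_real_eq_massQ (X := Set.univ) (P := fun _ => true) (fun t => by simp)
  have hm : massQ (fun _ => true) = ZQ := by simp [massQ, ZQ]
  rw [hm, div_self hZ.ne'] at h
  -- `μ univ` is finite (a finite sum of finite masses), so `μ.real univ = 1` gives `μ univ = 1`
  have hfin : μ Set.univ ≠ ⊤ := by
    simp only [μ, Measure.coe_finsetSum, Measure.coe_smul, Finset.sum_apply, Pi.smul_apply, smul_eq_mul,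
      measure_univ, mul_one]
    exact ENNReal.sum_ne_top.2 fun t _ => ENNReal.ofReal_ne_top
  rw [← ENNReal.ofReal_toReal hfin, ← measureReal_def, h, ENNReal.ofReal_one]

/-- Point masses on the image of `conf`: `μ{conf s} = mQ s / Z`. [folklore] -/
theorem μ_real_singleton_conf (s : Finset (Fin 5)) : μ.real {conf s} = (mQ s : ℝ) / (ZQ : ℝ) := by
  rw [μ_real_apply, Finset.sum_eq_single s]
  · rw [if_pos (Set.mem_singleton _)]
  · intro t _ hts
    rw [if_neg (fun h => hts (conf_injective (Set.mem_singleton_iff.1 h)))]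
  · intro h; exact (h (Finset.mem_univ s)).elim

/-- Point masses off the image of `conf` vanish. [folklore] -/
theorem μ_real_singleton_eq_zero {a : BondConfig (Fin 4)} (h : ∀ s, conf s ≠ a) : μ.real {a} = 0 := by
  rw [μ_real_apply]
  exact Finset.sum_eq_zero fun t _ => if_neg (fun ht => h t (Set.mem_singleton_iff.1 ht))

/-- **`μ` satisfies the FKG lattice condition on point masses.** [cite: Grimmett2006, Thm. (2.19) (FKG lattice condition)] -/
theorem μ_lattice (a b : BondConfig (Fin 4)) :
    μ.real {a} * μ.real {b} ≤ μ.real {a ∩ b} * μ.real {a ∪ b} := by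
  have h0 : ∀ c : BondConfig (Fin 4), 0 ≤ μ.real {c} := fun c => measureReal_nonneg
  by_cases ha : ∃ s, conf s = a
  · by_cases hb : ∃ t, conf t = b
    · obtain ⟨s, rfl⟩ := ha
      obtain ⟨t, rfl⟩ := hb
      rw [← conf_inter, ← conf_union, μ_real_singleton_conf, μ_real_singleton_conf, μ_real_singleton_conf,
        μ_real_singleton_conf, div_mul_div_comm, div_mul_div_comm]
      have hZ : (0 : ℝ) < (ZQ : ℝ) := by rw [zq_eq]; push_cast; norm_num
      refine div_le_div_of_nonneg_right ?_ (mul_pos hZ hZ).le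
      exact_mod_cast mQ_lattice s t
    · push Not at hb
      rw [μ_real_singleton_eq_zero hb, mul_zero]
      exact mul_nonneg (h0 _) (h0 _)
  · push Not at ha
    rw [μ_real_singleton_eq_zero ha, zero_mul]
    exact mul_nonneg (h0 _) (h0 _)

end

/-! ### Correctness of the computable reachability test -/

/-- `adjB` computes adjacency in the open graph of `conf t`. [folklore] -/
theorem adjB_iff (t : Finset (Fin 5)) (x y : Fin 4) :
    adjB t x y = true ↔ (openGraph (conf t)).Adj x y := by
  rw [openGraph_adj, conf, Finset.mem_coe, Finset.mem_map]
  simp only [adjB, Bool.and_eq_true, decide_eq_true_eq, List.any_eq_true, List.mem_finRange, true_and,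
    Bool.or_eq_true]
  constructor
  · rintro ⟨hne, i, hi, h⟩
    refine ⟨⟨i, hi, ?_⟩, hne⟩
    change s(src i, dst i) = s(x, y)
    rcases h with ⟨h1, h2⟩ | ⟨h1, h2⟩
    · rw [h1, h2]
    · rw [h1, h2, Sym2.eq_swap]
  · rintro ⟨⟨i, hi, h⟩, hne⟩
    refine ⟨hne, i, hi, ?_⟩
    change s(src i, dst i) = s(x, y) at h
    rw [Sym2.eq_iff] at h
    rcases h with ⟨h1, h2⟩ | ⟨h1, h2⟩
    · exact Or.inl ⟨h1, h2⟩
    · exact Or.inr ⟨h1, h2⟩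

/-- `reachWithin t k u v` holds iff there is an open walk of length `≤ k` from `u` to `v`. [folklore] -/
theorem reachWithin_iff (t : Finset (Fin 5)) (k : ℕ) (u v : Fin 4) :
    reachWithin t k u v = true ↔ ∃ p : (openGraph (conf t)).Walk u v, p.length ≤ k := by
  induction k generalizing u with
  | zero =>
    simp only [reachWithin, decide_eq_true_eq, Nat.le_zero]
    constructor
    · rintro rfl; exact ⟨SimpleGraph.Walk.nil, rfl⟩
    · rintro ⟨p, hp⟩; exact (SimpleGraph.Walk.eq_of_length_eq_zero hp)
  | succ k ih =>
    simp only [reachWithin, Bool.or_eq_true, decide_eq_true_eq, List.any_eq_true, List.mem_finRange, true_and,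
      Bool.and_eq_true, adjB_iff, ih]
    constructor
    · rintro (rfl | ⟨w, hw, p, hp⟩)
      · exact ⟨SimpleGraph.Walk.nil, Nat.zero_le _⟩
      · exact ⟨SimpleGraph.Walk.cons hw p, by rw [SimpleGraph.Walk.length_cons]; omega⟩
    · rintro ⟨p, hp⟩
      cases p with
      | nil => exact Or.inl rfl
      | cons h q =>
        refine Or.inr ⟨_, h, q, ?_⟩
        rw [SimpleGraph.Walk.length_cons] at hp
        omega

/-- **`reachB` computes reachability** in the open graph of `conf t` (a path on four vertices has length `≤ 3`). [folklore] -/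
theorem reachB_iff (t : Finset (Fin 5)) (u v : Fin 4) :
    reachB t u v = true ↔ (openGraph (conf t)).Reachable u v := by
  classical
  rw [reachB, reachWithin_iff]
  constructor
  · rintro ⟨p, _⟩; exact ⟨p⟩
  · intro h
    obtain ⟨p, hp⟩ := h.exists_isPath
    refine ⟨p, ?_⟩
    have := hp.length_lt
    simp only [Fintype.card_fin] at this
    omega

/-- Membership of `conf t` in a connection event is computed by `reachB`. [folklore] -/
theorem conf_mem_openConn_iff (t : Finset (Fin 5)) (u v : Fin 4) :
    conf t ∈ openConn u v ↔ reachB t u v = true := by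
  rw [reachB_iff]; rfl

/-! ### The refutation -/

noncomputable section

/-- `μ(0 ↔ 1) = 1928320/1929685`. (transcription of FK-Q2.md §6.5) -/
theorem μ_conn01 : μ.real (openConn 0 1) = 1928320 / 1929685 := by
  rw [μ_real_eq_massQ (P := fun t => reachB t 0 1) (fun t => conf_mem_openConn_iff t 0 1), mass_conn01, zq_eq]
  push_cast; norm_num

/-- `μ(0 ↔ {2, 3}) = 1928776/1929685`. (transcription of FK-Q2.md §6.5) -/
theorem μ_conn0A : μ.real (⋃ a ∈ ({2, 3} : Finset (Fin 4)), openConn 0 a) = 1928776 / 1929685 := by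
  rw [μ_real_eq_massQ (P := fun t => reachB t 0 2 || reachB t 0 3), mass_conn0A, zq_eq]
  · push_cast; norm_num
  · intro t
    simp only [Set.mem_iUnion, Finset.mem_insert, Finset.mem_singleton, exists_prop, Bool.or_eq_true,
      ← conf_mem_openConn_iff]
    constructor
    · rintro ⟨a, (rfl | rfl), ha⟩
      · exact Or.inl ha
      · exact Or.inr ha
    · rintro (h | h)
      · exact ⟨2, Or.inl rfl, h⟩
      · exact ⟨3, Or.inr rfl, h⟩

/-- `μ(2 ↔ 1) = 1929236/1929685`. (transcription of FK-Q2.md §6.5) -/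
theorem μ_conn21 : μ.real (openConn 2 1) = 1929236 / 1929685 := by
  rw [μ_real_eq_massQ (P := fun t => reachB t 2 1) (fun t => conf_mem_openConn_iff t 2 1), mass_conn21, zq_eq]
  push_cast; norm_num

/-- `μ(3 ↔ 1) = 1929252/1929685`. (transcription of FK-Q2.md §6.5) -/
theorem μ_conn31 : μ.real (openConn 3 1) = 1929252 / 1929685 := by
  rw [μ_real_eq_massQ (P := fun t => reachB t 3 1) (fun t => conf_mem_openConn_iff t 3 1), mass_conn31, zq_eq]
  push_cast; norm_num

/-- **Additive gluing fails for `μ`** with `o = 0`, `b = 1`, `A = {2, 3}` and slack `t = μ(2 ↮ 1) = 449/1929685`: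
`μ(0 ↔ A) − t = 1928327/1929685 > μ(0 ↔ 1) = 1928320/1929685`. (transcription of FK-Q2.md §6.5) -/
theorem not_additiveGluingUnder_μ : ¬ AdditiveGluingUnder μ ({2, 3} : Finset (Fin 4)) 0 1 := by
  intro h
  have key := h (449 / 1929685) (by norm_num) (fun a ha => by
    simp only [Finset.mem_insert, Finset.mem_singleton] at ha
    rcases ha with rfl | rfl
    · rw [μ_conn21]; norm_num
    · rw [μ_conn31]; norm_num)
  rw [μ_conn0A, μ_conn01] at key
  norm_num at key

end

end FKGLatticeCex

/-- **`FK.AdditiveGluingFKGLattice` is false**: the monotonic (FKG-lattice) probability measure `FKGLatticeCex.μ` on the bond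
configurations of `Fin 4` (ferromagnetic pairwise tilt of the density-`4/5` product measure on `K₄ ∖ {01}`, FK-Q2.md §6.5) violates
additive gluing at `o = 0`, `b = 1`, `A = {2, 3}` by `7/1929685`.  So the finite gluing inequalities of the CSH chain are not consequences
of the FKG lattice condition alone; the random-cluster conjecture `FK.AdditiveGluingFKMonotone` is not affected. (transcription of the
memo FK-Q2.md §6.5 of seat prim-bschramm-fk-2; builds on p205010 (kernel theorem, internal audit signed; external expert review pending))
[cite: Grimmett2006, Thm. (2.19) and Thm. (2.24)] -/
theorem not_additiveGluingFKGLattice : ¬ AdditiveGluingFKGLattice := by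
  intro h
  exact FKGLatticeCex.not_additiveGluingUnder_μ
    (h 4 FKGLatticeCex.μ ⟨FKGLatticeCex.μ_univ.1⟩ FKGLatticeCex.μ_lattice ({2, 3} : Finset (Fin 4)) 0 1)

end FK

end Summit.CriticalPhenomena.PercolationContinuityZ3.Theorems
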